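import Summits.AtomisticToContinuum.BoseEinsteinCondensation.Theorems.BECCutLineWeakDisorderGroundStateRigidityEssBounded
import HarnessLib

/-!
# Crux `GroundStateRigidity` (stmt-AtomisticToContinuum-9072), line `Sketch`:
# the registered stub `stub_layerKineticVanishing`

Supports (does not close) stmt-AtomisticToContinuum-9072; registered stub
`stub_layerKineticVanishing` (Stub 15d) of line Sketch (lead c4). **Vanishing kinetic energy in
thin contact layers.** For ONE fixed function `Φ` on `(ℝ³)^N` of finite kinetic energy
`∫ |∇Φ|² < ∞` and a contact radius `b`, the kinetic energy inside the layers
`U_s = {X | ∃ i ≠ j, b - s < |xᵢ - xⱼ| < b + 3s}` is `≤ ε` for some `s > 0`, for every `ε > 0`.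

## Proof

`μ := |∇Φ|² dX = volume.withDensity (kineticDensity Φ)` is a finite measure and
`∫ 1_{U_s} |∇Φ|² = μ U_s` (`U_s` is measurable). The family `U_s` increases with `s`, and
`⋂_{s>0} U_s ⊆ Z := {X | ∃ i ≠ j, |xᵢ - xⱼ| = b}`: if all pair distances of `X` differ from `b`
then, there being finitely many pairs, for all small `s > 0` no pair distance lies in
`(b - s, b + 3s)`. `Z` is a finite union of the Lebesgue-null sets `{|xᵢ - xⱼ| ∈ {b}}`
(`volume_setOf_dist_mem_eq_zero`), hence `μ`-null (`withDensity_absolutelyContinuous`).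
Continuity of the finite measure `μ` from above along `s ↓ 0` (`tendsto_measure_biInter_gt`)
gives `μ U_s → μ (⋂_{s>0} U_s) = 0`, so `μ U_s ≤ ε` for some `s > 0`. (The `C¹` hypothesis of
the registered signature is not needed for this measure-theoretic step.) No auxiliary
definitions: the layer `U_s` and the contact set `Z` are written out as set-builder terms.
-/

noncomputable section

open MeasureTheory Filter Set Metric
open scoped ENNReal NNReal Topology

namespace Summit.AtomisticToContinuum.BoseEinsteinCondensation.Theorems.GroundStateRigidity

open Literature.MathematicalPhysics.QuantumManyBody.BoseGas

namespace LayerKinetic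

variable {N : ℕ}

/-- The layer `U_s = {X | ∃ i ≠ j, b - s < |xᵢ - xⱼ| < b + 3s}` is measurable (countably many
measurable conditions). [folklore] -/
theorem measurableSet_layer (b s : ℝ) :
    MeasurableSet {Y : Config N | ∃ i j : Fin N, i ≠ j ∧ b - s < dist (Y i) (Y j) ∧
      dist (Y i) (Y j) < b + 3 * s} := by
  have hd : ∀ i j : Fin N, Measurable fun Y : Config N => dist (Y i) (Y j) := fun i j =>
    ((continuous_apply i).dist (continuous_apply j)).measurable
  refine measurableSet_setOf.2 (Measurable.exists fun i => Measurable.exists fun j =>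
    measurable_const.and (Measurable.and ?_ ?_))
  · exact measurableSet_setOf.1 (measurableSet_lt measurable_const (hd i j))
  · exact measurableSet_setOf.1 (measurableSet_lt (hd i j) measurable_const)

/-- **The pair-contact set `Z = {X | ∃ i ≠ j, |xᵢ - xⱼ| = b}` is Lebesgue-null**: it is a finite
union of the null sets `{|xᵢ - xⱼ| ∈ {b}}`, `i ≠ j` (`volume_setOf_dist_mem_eq_zero`). [folklore] -/
theorem volume_contactSet_eq_zero (b : ℝ) :
    volume {Y : Config N | ∃ i j : Fin N, i ≠ j ∧ dist (Y i) (Y j) = b} = 0 := by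
  have h : {Y : Config N | ∃ i j : Fin N, i ≠ j ∧ dist (Y i) (Y j) = b} ⊆
      ⋃ i : Fin N, ⋃ j : Fin N, ⋃ (_ : i ≠ j),
        {Y : Config N | dist (Y i) (Y j) ∈ ({b} : Set ℝ)} := by
    rintro Y ⟨i, j, hij, hY⟩
    exact mem_iUnion.2 ⟨i, mem_iUnion.2 ⟨j, mem_iUnion.2 ⟨hij, hY⟩⟩⟩
  refine measure_mono_null h
    (measure_iUnion_null fun i => measure_iUnion_null fun j => measure_iUnion_null fun hij => ?_)
  exact volume_setOf_dist_mem_eq_zero hij (measurableSet_singleton b) Real.volume_singleton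

/-- **The layers shrink to the contact set**: `⋂_{s > 0} U_s ⊆ Z`. If every pair distance of `X`
differs from `b`, then for each of the finitely many pairs the distance is outside
`(b - s, b + 3s)` for all small `s > 0`, so `X ∉ U_s` for some `s > 0`. [folklore] -/
theorem iInter_layer_subset_contactSet (b : ℝ) :
    ⋂ s > (0 : ℝ), {Y : Config N | ∃ i j : Fin N, i ≠ j ∧ b - s < dist (Y i) (Y j) ∧
        dist (Y i) (Y j) < b + 3 * s} ⊆
      {Y : Config N | ∃ i j : Fin N, i ≠ j ∧ dist (Y i) (Y j) = b} := by
  intro Y hY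
  rw [mem_iInter₂] at hY
  by_contra hZ
  simp only [mem_setOf_eq, not_exists, not_and] at hZ
  have hsmall : ∀ c : ℝ, 0 < c → ∀ᶠ s in 𝓝[>] (0 : ℝ), s < c := fun c hc =>
    (eventually_lt_nhds hc).filter_mono nhdsWithin_le_nhds
  -- for each pair, eventually (as `s ↓ 0`) the pair distance is outside `(b - s, b + 3s)`
  have hpair : ∀ i j : Fin N, ∀ᶠ s in 𝓝[>] (0 : ℝ),
      ¬ (i ≠ j ∧ b - s < dist (Y i) (Y j) ∧ dist (Y i) (Y j) < b + 3 * s) := by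
    intro i j
    by_cases hij : i = j
    · exact Eventually.of_forall fun s h => h.1 hij
    · rcases lt_or_gt_of_ne (hZ i j hij) with hlt | hgt
      · filter_upwards [hsmall (b - dist (Y i) (Y j)) (sub_pos.2 hlt)] with s hs h
        linarith [h.2.1]
      · filter_upwards [hsmall ((dist (Y i) (Y j) - b) / 3) (by linarith)] with s hs h
        linarith [h.2.2]
  have hall : ∀ᶠ s in 𝓝[>] (0 : ℝ), ∀ i j : Fin N,
      ¬ (i ≠ j ∧ b - s < dist (Y i) (Y j) ∧ dist (Y i) (Y j) < b + 3 * s) :=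
    eventually_all.2 fun i => eventually_all.2 fun j => hpair i j
  obtain ⟨s, hs, hs0⟩ := (hall.and self_mem_nhdsWithin).exists
  obtain ⟨i, j, hij, h1, h2⟩ := hY s hs0
  exact hs i j ⟨hij, h1, h2⟩

/-- **Continuity from above**: for `μ = |∇Φ|² dX` of finite total mass, `μ U_s → 0` as `s ↓ 0`
(`tendsto_measure_biInter_gt` along the increasing measurable family `U_s`; the limit is
`μ (⋂_{s>0} U_s) ≤ μ Z = 0` since `μ ≪ volume`). [folklore] -/
theorem tendsto_measure_layer (b : ℝ) (Φ : Config N → ℂ) (hfin : ∫⁻ X, kineticDensity Φ X ≠ ⊤) :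
    Tendsto (fun s : ℝ => volume.withDensity (kineticDensity Φ)
      {Y : Config N | ∃ i j : Fin N, i ≠ j ∧ b - s < dist (Y i) (Y j) ∧
        dist (Y i) (Y j) < b + 3 * s}) (𝓝[>] (0 : ℝ)) (𝓝 0) := by
  set μ : Measure (Config N) := volume.withDensity (kineticDensity Φ) with hμ
  set U : ℝ → Set (Config N) := fun s => {Y : Config N | ∃ i j : Fin N, i ≠ j ∧
    b - s < dist (Y i) (Y j) ∧ dist (Y i) (Y j) < b + 3 * s} with hU
  haveI : IsFiniteMeasure μ := isFiniteMeasure_withDensity hfin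
  have hmono : ∀ s t : ℝ, s ≤ t → U s ⊆ U t := by
    rintro s t hst Y ⟨i, j, hij, h1, h2⟩
    exact ⟨i, j, hij, by linarith, by linarith⟩
  have hZ : μ (⋂ s > (0 : ℝ), U s) = 0 :=
    measure_mono_null (iInter_layer_subset_contactSet b)
      (withDensity_absolutelyContinuous _ _ (volume_contactSet_eq_zero b))
  have h := tendsto_measure_biInter_gt (μ := μ) (s := U) (a := (0 : ℝ))
    (fun r _ => (measurableSet_layer b r).nullMeasurableSet)
    (fun s t _ hst => hmono s t hst) ⟨1, one_pos, measure_ne_top μ _⟩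
  rw [hZ] at h
  exact h

end LayerKinetic

/-! ### The stub -/

open LayerKinetic in
/-- **Stub `stub_layerKineticVanishing` of line `Sketch` — vanishing kinetic energy in thin contact
layers.** For a `C¹` function `Φ` on `(ℝ³)^N` with `∫ |∇Φ|² < ∞`, a radius `b` and `ε > 0`, there
is `s > 0` with `∫_{U_s} |∇Φ|² ≤ ε`, `U_s = {X | ∃ i ≠ j, b - s < |xᵢ - xⱼ| < b + 3s}`: the finite
measure `|∇Φ|² dX` of `U_s` tends, as `s ↓ 0`, to that of `⋂_{s>0} U_s ⊆ {∃ i ≠ j, |xᵢ - xⱼ| = b}`,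
a Lebesgue-null set (`LayerKinetic.tendsto_measure_layer`), and
`∫ 1_{U_s} |∇Φ|² = (|∇Φ|² dX)(U_s)` (`lintegral_indicator`, `withDensity_apply`). [folklore] -/
theorem stub_layerKineticVanishing :
    ∀ (N : ℕ) (b : ℝ) (Φ : Config N → ℂ), ContDiff ℝ 1 Φ → ∫⁻ X, kineticDensity Φ X ≠ ⊤ →
      ∀ ε : ℝ≥0∞, 0 < ε → ∃ s : ℝ, 0 < s ∧
        ∫⁻ X, {Y : Config N | ∃ i j : Fin N, i ≠ j ∧ b - s < dist (Y i) (Y j) ∧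
            dist (Y i) (Y j) < b + 3 * s}.indicator (kineticDensity Φ) X ≤ ε := by
  intro N b Φ _hΦ hfin ε hε
  obtain ⟨s, hs, hs0⟩ :=
    (((tendsto_measure_layer b Φ hfin).eventually_le_const hε).and self_mem_nhdsWithin).exists
  refine ⟨s, hs0, ?_⟩
  rwa [lintegral_indicator (measurableSet_layer b s),
    ← withDensity_apply _ (measurableSet_layer b s)]

end Summit.AtomisticToContinuum.BoseEinsteinCondensation.Theorems.GroundStateRigidity

end
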